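/-
Copyright (c) 2026 the pub-hodgecm-mathlib formalisation cell (harness21).  Prover seat hodgecm-mathlib-LH4-p02 (g5), 2026-09-02: «NORM-ONE TORUS AT A RAMIFIED CM PLACE —
Hilbert 90 dress + σ-DEPTH CORRESPONDENCE» (name F0P3a-p06 (g18); wild base layer of the (D-RAM) column, next to ★ `RamifiedPlaceSigmaDepth` and the MARS index).
-/
import Literature.NumberTheory.Automorphic.RamifiedPlaceSigmaDepth   -- ★ p850961: `valued_galAdicCompletionMap_sub_self_le_iff_mem_order`; brings ★ p850872 `RamifiedPlaceDifferent` (§5 skew line, §6 residual depth) and ★ `RamifiedPlaceEisensteinBasis`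
import HarnessLib

/-!
# The NORM-ONE TORUS `T = {t ∈ L_w : σ_w t · t = 1}` at a RAMIFIED CM place (any residue characteristic): Hilbert 90 dress, the two cosets `T = T⁽ᵈ⁾ ⊔ (τ∕στ)·T⁽ᵈ⁾`,
# and the σ-DEPTH CORRESPONDENCE `T⁽ᵈ⁺²ʲ⁾ = {u∕σu : u ∈ (𝒪_v + ϖ_v^j 𝒪_w)^×}` (Serre, *Local Fields* X §1, IV §1–2, V §3; Flicker 1998 Prop. 7 (b))

Topic `NumberTheory/Automorphic`; namespace `Literature.NumberTheory.Automorphic.UnitaryGroup`.  THEOREMS ONLY (no definition, no instance, no notation, no named fact,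
no `sorry`; axioms ⊆ {propext, Classical.choice, Quot.sound}).  Cell `pub/hodgecm-mathlib` (D-0151), crux H413 = `stmt-HodgeConjecture-24833`; half A line LH4, DYADIC
pay-down leaf `Cruxes/H413/Lines/F0_P3c_DyadicPaydown.lean`, organ (D-RAM) (PRINT by ruling D74′; scope audit LH4-plan (g5) b4c7662647f1db69 «COVERED at v ∣ 2»).  HONEST
READER LABEL: this file is BANKED base layer, consumers none live; HC_CM is proved only modulo the 7 printed citations (2 remaining named inputs: hLiu418 =
stmt-HodgeConjecture-24832, h413 = stmt-HodgeConjecture-24833) until rung 0 closes; unconditional local algebra, count-neutral, pays no letter by itself.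

SETTING (= ★ `RamifiedPlaceDifferent` ∕ ★ `RamifiedPlaceSigmaDepth`).  `L` CM, `v` a finite place of `L⁺`, `w ∣ v` with `c • w = w` and `e(w|v) ≠ 1`; `F := L⁺_v`, `E := L_w`,
`ι = toPlace v w`, `σ = σ_w = galAdicCompletionMap c hw` (`σ ∘ ι = ι`, `σσ = 1`, `|σ x| = |x|`), `τ` a uniformiser of `E`, `D := |στ − τ| = exp(−d)` the different number
(★ `exists_different_of_ramified`).  NORM-ONE LETTER = the tree's binder shape `σ t * t = 1` (★ `hu1 : ∀ i, galAdicCompletionMap … (u i) * u i = 1`); COBOUNDARY LETTER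
`z ∕ σ z` (field division).  The norm-one torus `T = U(1)(L⁺_v) ⊂ 𝒪_w^×` is what every type-(1)∕(2) torus orbital integral at a ramified place filters; the TAME order-index
file ★ `LocalFields/RamifiedQuadraticOrderUnitIndex` (Flicker Prop. 7 (a), `[R_E^× : R_E(j)^×] = q^j`) left «the norm-one version `[R_E¹ : R_E(j)¹] = q^j` (Prop. 7 (b))
cut on request» (its docstring :31) — THIS file supplies, at ANY ramified place, the structure that reduces (b) to (a): `T⁽ᵈ⁺²ʲ⁾` is the image of the σ-depth-`(d+2j)` units
under `u ↦ u∕σu`, with kernel `ι(𝒪_v^×)`.  (The index identity `[T⁽ᵈ⁾ : T⁽ᵈ⁺²ʲ⁾] = q_v^j` itself is the composition with the MARS index file and is NOT stated here.)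

* §1 COBOUNDARIES.  `galAdicCompletionMap_div_mul_div_eq_one` (`z∕σz ∈ T`), `mul_div_galAdicCompletionMap_mul` (`u ↦ u∕σu` is multiplicative), `toPlace_mul_div_galAdicCompletionMap`
  (rescaling by `ι c` does not change `z∕σz`), and **HILBERT 90** `exists_eq_div_galAdicCompletionMap_of_norm_one`: `σt·t = 1 → ∃ z ≠ 0, t = z∕σz` — the quadratic case by
  hand (`t ≠ −1 ⇒ z = 1 + t`, since `t·σ(1+t) = t + t·σt = 1 + t`; `t = −1 = (τ − στ)∕σ(τ − στ)`); the general cyclic statement is ★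
  `Literature.RingTheory.GaloisAlgebras.HilbertNinetyAlgebras.hilbert90_cyclic_of_charZero` (not imported: it wants `σ` as a `RingAut` and a twisted-norm product), and the
  BLOCK-MODEL twin (`E_v = ∏_{w ∣ v} E_w`, `conjLocal`, `normOneUnits`) is ★ `LocalNormOneHilbert90.exists_map_conjLocal_div_eq_of_mem_normOneUnits` — this file is the
  ONE-PLACE `galAdicCompletionMap` currency of the ramified-place kit, with the integral refinement (which `z`: a unit or a uniformiser) that the block model does not carry.
* §2 DEPTH OF A COBOUNDARY.  `valued_div_galAdicCompletionMap_sub_one`: `|z∕σz − 1| = |σz − z| ∕ |z|`; for a UNIT `u`: `|u∕σu − 1| = |σu − u| ≤ D` (★ FILE 1 §6) — depth `≥ d`; for the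
  UNIFORMISER: `|τ∕στ − 1| = D·exp 1` — depth `d − 1` EXACTLY; and `|u∕σu · τ∕στ − 1| = D·exp 1` for every unit `u`.
* §3 NORMALISATION AND THE DICHOTOMY.  `exists_div_galAdicCompletionMap_eq_or`: for `z ≠ 0`, `z∕σz = u∕σu` (`ord z` even) or `= u∕σu · τ∕στ` (`ord z` odd) with `u` a unit (rescale by
  `ι ϖ_v^k`); hence **`exists_eq_div_or_of_norm_one`**: every `t ∈ T` is `u∕σu` or `u∕σu · τ∕στ`, `u ∈ 𝒪_w^×`, the two kinds told apart by depth
  (`valued_sub_one_le_or_eq_of_norm_one`: `|t − 1| ≤ D` or `|t − 1| = D·exp 1`; **`exists_eq_div_of_norm_one_of_valued_sub_one_le`**: `T⁽ᵈ⁾ = {u∕σu}`;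
  `exists_eq_div_mul_of_norm_one_of_not_le`: the other coset) — `[T : T⁽ᵈ⁾] = 2`, `T⁽ᵈ⁻¹⁾ = T`, nothing strictly between.
* §4 σ-DEPTH CORRESPONDENCE.  `valued_div_galAdicCompletionMap_sub_one_le_iff` (`|u∕σu − 1| ≤ c ↔ |σu − u| ≤ c` for a unit), **`valued_sub_one_le_iff_exists_of_norm_one`**:
  `t ∈ T` has `|t − 1| ≤ exp(−2j)·D ↔ t = x∕σx` for some `x = ι a + ι(ϖ_v^j b)·τ`, `|a| = 1`, `|b| ≤ 1` (★ `valued_galAdicCompletionMap_sub_self_le_iff_mem_order`: `T⁽ᵈ⁺²ʲ⁾` = image of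
  `(𝒪_v + ϖ_v^j 𝒪_w)^×`); NO ODD STEPS `valued_sub_one_le_of_le_odd_of_norm_one` (`T⁽ᵈ⁺²ʲ⁺¹⁾ = T⁽ᵈ⁺²ʲ⁺²⁾`); KERNEL `div_galAdicCompletionMap_eq_div_galAdicCompletionMap_iff`
  (`x∕σx = y∕σy ↔ y ∈ ι(L⁺_v)·x`, descent ★ `exists_toPlace_eq_of_galAdicCompletionMap_eq`) and its unit dress.

## References
* [Serre1979] J.-P. Serre, *Local Fields*, GTM 67 (1979): Ch. X §1 Prop. 2 (Hilbert 90), Ch. IV §1 Prop. 4, Ch. IV §2 (quadratic `i_G(σ) = ord(στ − τ)`), Ch. V §3 (norm and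
  filtration in a totally ramified cyclic extension).
* [NeukirchANT1999] J. Neukirch, *Algebraic Number Theory* (1999): Ch. IV (3.8) (Hilbert 90), Ch. I §12 (orders `𝒪 + 𝔣𝒪_K`).
* [Flicker1998UnitaryFL] Y. Z. Flicker, *Elementary proof of the fundamental lemma for a unitary group*, Canad. J. Math. 50 (1998), Prop. 7 p. 84 ((a) `[R_E^× : R_E(j)^×] = q^j`,
  (b) `[R_E¹ : R_E(j)¹] = q^j`) — stated there for `p > 2` (TAME shadow only: `d = 1`, filtration steps `2j + 1`); here ANY residue characteristic, steps `d + 2j`.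
* [CasselsFrohlichANT1967] J. W. S. Cassels, A. Fröhlich (eds.), *Algebraic Number Theory* (1967), Ch. VII §1.1 (`|σ x| = |x|`), §7.4 Cor. (a) (Hilbert 90, local blocks).
-/

set_option autoImplicit false

noncomputable section

open NumberField IsDedekindDomain ValuativeRel
open scoped ValuativeRel WithZero

namespace Literature.NumberTheory.Automorphic.UnitaryGroup

variable (L : Type) [Field L] [NumberField L] [IsCMField L] (v : HeightOneSpectrum (𝓞 ↥(maximalRealSubfield L)))
  (w : PlacesOver L v) (hw : IsCMField.complexConj L • w.1 = w.1) (he : v.asIdeal.ramificationIdx' w.1.asIdeal ≠ 1)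

/-! ## §0 Scalars: `σσ = 1`, norm one ⇒ valuation one, `x < x · exp 1` -/

/-- `σ_w σ_w = 1` on `L_w` (★ `galAdicCompletionMap_galAdicCompletionMap_of_smul_eq`, curried). [cite: Serre1979, Ch. IV §2] -/
private theorem galAdicCompletionMap_galAdicCompletionMap' (x : w.1.adicCompletion L) :
    galAdicCompletionMap (L := L) (IsCMField.complexConj L) hw (galAdicCompletionMap (L := L) (IsCMField.complexConj L) hw x) = x :=
  galAdicCompletionMap_galAdicCompletionMap_of_smul_eq (IsCMField.complexConj L) w (IsCMField.complexConj_ne_one L) hw x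

/-- Norm one forces valuation one: `σ_w t · t = 1 ⇒ |t|_w = 1` (`σ_w` is isometric) — the `Valued.v` twin of ★
`Rogawski1990.…FlickerRepresentatives.valuation_eq_one_of_galAdicCompletionMap_mul_self_eq_one` (kept private to spare the `U(3)` import). [cite: Serre1979, Ch. V §3] -/
private theorem valued_eq_one_of_norm_one {t : w.1.adicCompletion L} (ht : galAdicCompletionMap (L := L) (IsCMField.complexConj L) hw t * t = 1) : Valued.v t = 1 := by
  have h : Valued.v (galAdicCompletionMap (L := L) (IsCMField.complexConj L) hw t * t) = 1 := by rw [ht, map_one]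
  rw [map_mul, valued_galAdicCompletionMap, ← pow_two] at h
  exact eq_of_sq_eq_sq (by rw [h, one_pow])

omit [IsCMField L] in
/-- A unit is non-zero. [folklore] -/
private theorem ne_zero_of_valued_eq_one {x : w.1.adicCompletion L} (hx : Valued.v x = 1) : x ≠ 0 :=
  fun h => zero_ne_one (by rw [← hx, h, map_zero])

/-- In `ℤᵐ⁰`: `x < x · exp 1` for `x ≠ 0`. [cite: Serre1979, Ch. II §1] -/
private theorem lt_mul_exp_one {x : WithZero (Multiplicative ℤ)} (hx : x ≠ 0) : x < x * WithZero.exp (1 : ℤ) := by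
  obtain ⟨m, hm⟩ : ∃ m : ℤ, x = WithZero.exp m := ⟨_, (WithZero.exp_log hx).symm⟩
  rw [hm, ← WithZero.exp_add, WithZero.exp_lt_exp]; omega

/-- In `ℤᵐ⁰`: `exp(−n) ≤ 1` for `n : ℕ`, and so `exp(−n) · x ≤ x`. [cite: Serre1979, Ch. II §1] -/
private theorem exp_neg_natCast_mul_le (n : ℕ) (x : WithZero (Multiplicative ℤ)) : WithZero.exp (-(n : ℤ)) * x ≤ x := by
  refine mul_le_of_le_one_left zero_le ?_
  rw [← WithZero.exp_zero, WithZero.exp_le_exp]; omega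

/-! ## §1 Coboundaries `z ∕ σz` are norm-one; Hilbert 90 -/

/-- **`z∕σz ∈ T`**: `σ(z∕σz) · (z∕σz) = 1` for `z ≠ 0` (`σ(z∕σz) = σz∕z`). [cite: Serre1979, Ch. X §1 Prop. 2] -/
theorem galAdicCompletionMap_div_mul_div_eq_one {z : w.1.adicCompletion L} (hz : z ≠ 0) :
    galAdicCompletionMap (L := L) (IsCMField.complexConj L) hw (z / galAdicCompletionMap (L := L) (IsCMField.complexConj L) hw z) *
      (z / galAdicCompletionMap (L := L) (IsCMField.complexConj L) hw z) = 1 := by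
  have hσz : galAdicCompletionMap (L := L) (IsCMField.complexConj L) hw z ≠ 0 := (_root_.map_ne_zero _).2 hz
  rw [map_div₀, galAdicCompletionMap_galAdicCompletionMap' L v w hw, div_mul_div_comm, mul_comm z, div_self (mul_ne_zero hσz hz)]

/-- **`u ↦ u∕σu` IS MULTIPLICATIVE**: `xy∕σ(xy) = x∕σx · y∕σy`. [cite: Serre1979, Ch. X §1] -/
theorem mul_div_galAdicCompletionMap_mul (x y : w.1.adicCompletion L) :
    x * y / galAdicCompletionMap (L := L) (IsCMField.complexConj L) hw (x * y) =
      x / galAdicCompletionMap (L := L) (IsCMField.complexConj L) hw x * (y / galAdicCompletionMap (L := L) (IsCMField.complexConj L) hw y) := by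
  rw [map_mul, div_mul_div_comm]

/-- **RESCALING BY `ι(L⁺_v)` DOES NOT CHANGE THE COBOUNDARY**: `(ι c · z)∕σ(ι c · z) = z∕σz` for `c ≠ 0` (`σ` fixes `ι c`). [cite: Serre1979, Ch. X §1] -/
theorem toPlace_mul_div_galAdicCompletionMap {c : v.adicCompletion ↥(maximalRealSubfield L)} (hc : c ≠ 0) (z : w.1.adicCompletion L) :
    toPlace v w c * z / galAdicCompletionMap (L := L) (IsCMField.complexConj L) hw (toPlace v w c * z) =
      z / galAdicCompletionMap (L := L) (IsCMField.complexConj L) hw z := by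
  rw [map_mul, galAdicCompletionMap_toPlace (IsCMField.complexConj L) w w hw c, mul_div_mul_left _ _ ((_root_.map_ne_zero (toPlace v w)).2 hc)]

include he in
/-- **HILBERT 90 AT A RAMIFIED CM PLACE (quadratic, by hand)**: every norm-one `t` (`σt · t = 1`) is a coboundary `t = z∕σz` with `z ≠ 0` — `z := 1 + t` when `t ≠ −1`
(`t · σ(1 + t) = t + t·σt = 1 + t`), and `z := τ − στ` (skew, non-zero at a ramified place by ★ `galAdicCompletionMap_ne_self_of_uniformizer`) when `t = −1`.  The general
cyclic statement is ★ `HilbertNinetyAlgebras.hilbert90_cyclic_of_charZero` :291; the block-model (`∏_{w ∣ v} E_w`, `conjLocal`) twin is ★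
`LocalNormOneHilbert90.exists_map_conjLocal_div_eq_of_mem_normOneUnits` :76. [cite: Serre1979, Ch. X §1 Prop. 2] [cite: NeukirchANT1999, Ch. IV (3.8)] [cite: CasselsFrohlichANT1967, Ch. VII §7.4 Cor. (a)] -/
theorem exists_eq_div_galAdicCompletionMap_of_norm_one {t : w.1.adicCompletion L} (ht : galAdicCompletionMap (L := L) (IsCMField.complexConj L) hw t * t = 1) :
    ∃ z : w.1.adicCompletion L, z ≠ 0 ∧ t = z / galAdicCompletionMap (L := L) (IsCMField.complexConj L) hw z := by
  by_cases h1 : t = -1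
  · -- the skew witness `τ − στ`
    obtain ⟨π, hπ⟩ := w.1.valuation_exists_uniformizer L
    have hτ : Valued.v (π : w.1.adicCompletion L) = WithZero.exp (-1 : ℤ) := by rw [HeightOneSpectrum.valuedAdicCompletion_eq_valuation', hπ]
    have hδ : (π : w.1.adicCompletion L) - galAdicCompletionMap (L := L) (IsCMField.complexConj L) hw π ≠ 0 :=
      fun h => galAdicCompletionMap_ne_self_of_uniformizer L v w hw he hτ (sub_eq_zero.1 h).symm
    refine ⟨(π : w.1.adicCompletion L) - galAdicCompletionMap (L := L) (IsCMField.complexConj L) hw π, hδ, ?_⟩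
    rw [galAdicCompletionMap_sub_galAdicCompletionMap_self L v w hw, div_neg, div_self hδ, h1]
  · have hz : 1 + t ≠ 0 := fun h => h1 (eq_neg_of_add_eq_zero_right h)
    refine ⟨1 + t, hz, ?_⟩
    have hσz : galAdicCompletionMap (L := L) (IsCMField.complexConj L) hw (1 + t) ≠ 0 := (_root_.map_ne_zero _).2 hz
    rw [eq_div_iff hσz, map_add, map_one, mul_add, mul_one, mul_comm, ht, add_comm]

/-! ## §2 The depth of a coboundary -/

/-- **`|z∕σz − 1| = |σz − z| ∕ |z|`** for `z ≠ 0` (`z∕σz − 1 = (z − σz)∕σz`, `|σz| = |z|`). [cite: Serre1979, Ch. IV §1, Ch. V §3] -/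
theorem valued_div_galAdicCompletionMap_sub_one {z : w.1.adicCompletion L} (hz : z ≠ 0) :
    Valued.v (z / galAdicCompletionMap (L := L) (IsCMField.complexConj L) hw z - 1) =
      Valued.v (galAdicCompletionMap (L := L) (IsCMField.complexConj L) hw z - z) / Valued.v z := by
  have hσz : galAdicCompletionMap (L := L) (IsCMField.complexConj L) hw z ≠ 0 := (_root_.map_ne_zero _).2 hz
  have h : z / galAdicCompletionMap (L := L) (IsCMField.complexConj L) hw z - 1 =
      (z - galAdicCompletionMap (L := L) (IsCMField.complexConj L) hw z) / galAdicCompletionMap (L := L) (IsCMField.complexConj L) hw z := by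
    rw [sub_div, div_self hσz]
  rw [h, map_div₀, Valuation.map_sub_swap, valued_galAdicCompletionMap]

/-- **For a UNIT `u`: `|u∕σu − 1| = |σu − u|`** — the depth of the coboundary `u∕σu` is the σ-depth of `u`. [cite: Serre1979, Ch. V §3] [cite: Flicker1998UnitaryFL, Prop. 7 p. 84] -/
theorem valued_div_galAdicCompletionMap_sub_one_of_valued_eq_one {u : w.1.adicCompletion L} (hu : Valued.v u = 1) :
    Valued.v (u / galAdicCompletionMap (L := L) (IsCMField.complexConj L) hw u - 1) = Valued.v (galAdicCompletionMap (L := L) (IsCMField.complexConj L) hw u - u) := by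
  rw [valued_div_galAdicCompletionMap_sub_one L v w hw (ne_zero_of_valued_eq_one L v w hu), hu, div_one]

/-- **THE UNIFORMISER QUOTIENT HAS DEPTH `d − 1` EXACTLY**: `|τ∕στ − 1| = |στ − τ| · exp 1` (`= exp(−(d − 1))`) — the one depth of `T` below `d`. [cite: Serre1979, Ch. IV §2, Ch. V §3] -/
theorem valued_div_galAdicCompletionMap_sub_one_of_uniformizer {τ : w.1.adicCompletion L} (hτ : Valued.v τ = WithZero.exp (-1 : ℤ)) :
    Valued.v (τ / galAdicCompletionMap (L := L) (IsCMField.complexConj L) hw τ - 1) =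
      Valued.v (galAdicCompletionMap (L := L) (IsCMField.complexConj L) hw τ - τ) * WithZero.exp (1 : ℤ) := by
  have hτ0 : τ ≠ 0 := fun h => by rw [h, map_zero] at hτ; exact WithZero.zero_ne_coe hτ
  rw [valued_div_galAdicCompletionMap_sub_one L v w hw hτ0, hτ, div_eq_mul_inv, ← WithZero.exp_neg, neg_neg]

include he in
/-- **A UNIT COBOUNDARY HAS DEPTH `≥ d`**: `|u∕σu − 1| ≤ |στ − τ|` for `|u| = 1` (★ `valued_galAdicCompletionMap_sub_self_le_of_mem_integer`: `σ ≡ id (mod 𝔭_w^d)`).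
[cite: Serre1979, Ch. IV §1 Prop. 4, Ch. V §3] [cite: Flicker1998UnitaryFL, Prop. 7 p. 84] -/
theorem valued_div_galAdicCompletionMap_sub_one_le_of_valued_eq_one {τ : w.1.adicCompletion L} (hτ : Valued.v τ = WithZero.exp (-1 : ℤ)) {u : w.1.adicCompletion L}
    (hu : Valued.v u = 1) :
    Valued.v (u / galAdicCompletionMap (L := L) (IsCMField.complexConj L) hw u - 1) ≤ Valued.v (galAdicCompletionMap (L := L) (IsCMField.complexConj L) hw τ - τ) := by
  rw [valued_div_galAdicCompletionMap_sub_one_of_valued_eq_one L v w hw hu]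
  exact valued_galAdicCompletionMap_sub_self_le_of_mem_integer L v w hw he hτ hu.le

include he in
/-- **THE OTHER COSET HAS DEPTH `d − 1` EXACTLY**: `|u∕σu · τ∕στ − 1| = |στ − τ| · exp 1` for every unit `u` (`ab − 1 = a(b − 1) + (a − 1)` with `|a(b − 1)| = D·e > D ≥ |a − 1|`).
[cite: Serre1979, Ch. V §3] [cite: Flicker1998UnitaryFL, Prop. 7 p. 84] -/
theorem valued_div_galAdicCompletionMap_mul_sub_one_of_valued_eq_one {τ : w.1.adicCompletion L} (hτ : Valued.v τ = WithZero.exp (-1 : ℤ)) {u : w.1.adicCompletion L}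
    (hu : Valued.v u = 1) :
    Valued.v (u / galAdicCompletionMap (L := L) (IsCMField.complexConj L) hw u * (τ / galAdicCompletionMap (L := L) (IsCMField.complexConj L) hw τ) - 1) =
      Valued.v (galAdicCompletionMap (L := L) (IsCMField.complexConj L) hw τ - τ) * WithZero.exp (1 : ℤ) := by
  have hD0 := valued_galAdicCompletionMap_sub_self_ne_zero L v w hw he hτ
  have ha : Valued.v (u / galAdicCompletionMap (L := L) (IsCMField.complexConj L) hw u) = 1 := by rw [map_div₀, valued_galAdicCompletionMap, hu, div_one]
  have hsplit : u / galAdicCompletionMap (L := L) (IsCMField.complexConj L) hw u * (τ / galAdicCompletionMap (L := L) (IsCMField.complexConj L) hw τ) - 1 =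
      u / galAdicCompletionMap (L := L) (IsCMField.complexConj L) hw u * (τ / galAdicCompletionMap (L := L) (IsCMField.complexConj L) hw τ - 1) +
        (u / galAdicCompletionMap (L := L) (IsCMField.complexConj L) hw u - 1) := by ring
  have h1 : Valued.v (u / galAdicCompletionMap (L := L) (IsCMField.complexConj L) hw u * (τ / galAdicCompletionMap (L := L) (IsCMField.complexConj L) hw τ - 1)) =
      Valued.v (galAdicCompletionMap (L := L) (IsCMField.complexConj L) hw τ - τ) * WithZero.exp (1 : ℤ) := by
    rw [map_mul, ha, one_mul, valued_div_galAdicCompletionMap_sub_one_of_uniformizer L v w hw hτ]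
  have h2 : Valued.v (u / galAdicCompletionMap (L := L) (IsCMField.complexConj L) hw u - 1) <
      Valued.v (galAdicCompletionMap (L := L) (IsCMField.complexConj L) hw τ - τ) * WithZero.exp (1 : ℤ) :=
    lt_of_le_of_lt (valued_div_galAdicCompletionMap_sub_one_le_of_valued_eq_one L v w hw he hτ hu) (lt_mul_exp_one hD0)
  rw [hsplit, Valuation.map_add_of_distinct_val _ (by rw [h1]; exact h2.ne'), h1, max_eq_left h2.le]

/-! ## §3 Normalisation by `ι ϖ_v^k`, and the dichotomy on `T` -/

include he in
/-- **NORMALISATION**: for `z ≠ 0`, `z∕σz = u∕σu` (when `ord_w z` is even: `u = ι ϖ_v^k · z`) or `z∕σz = u∕σu · τ∕στ` (when `ord_w z` is odd: `ι ϖ_v^k · z = u · τ`) for some UNIT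
`u` — rescaling by `ι(L⁺_v)` is free (§1) and `|ι ϖ_v| = exp(−2)`. [cite: Serre1979, Ch. V §3] [cite: Flicker1998UnitaryFL, Prop. 7 p. 84] -/
theorem exists_div_galAdicCompletionMap_eq_or {τ : w.1.adicCompletion L} (hτ : Valued.v τ = WithZero.exp (-1 : ℤ)) {z : w.1.adicCompletion L} (hz : z ≠ 0) :
    ∃ u : w.1.adicCompletion L, Valued.v u = 1 ∧
      (z / galAdicCompletionMap (L := L) (IsCMField.complexConj L) hw z = u / galAdicCompletionMap (L := L) (IsCMField.complexConj L) hw u ∨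
        z / galAdicCompletionMap (L := L) (IsCMField.complexConj L) hw z =
          u / galAdicCompletionMap (L := L) (IsCMField.complexConj L) hw u * (τ / galAdicCompletionMap (L := L) (IsCMField.complexConj L) hw τ)) := by
  -- a uniformiser `ϖ` of `L⁺_v`, `|ι ϖ^k| = exp(-2k)`
  obtain ⟨π, hπ⟩ := v.valuation_exists_uniformizer ↥(maximalRealSubfield L)
  have hϖ : Valued.v (π : v.adicCompletion ↥(maximalRealSubfield L)) = WithZero.exp (-1 : ℤ) := by
    rw [HeightOneSpectrum.valuedAdicCompletion_eq_valuation', hπ]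
  set ϖ : v.adicCompletion ↥(maximalRealSubfield L) := (π : v.adicCompletion ↥(maximalRealSubfield L)) with hϖdef
  have hϖ0 : ϖ ≠ 0 := fun h => by rw [h, map_zero] at hϖ; exact WithZero.zero_ne_coe hϖ
  have hιϖ : ∀ k : ℤ, Valued.v (toPlace v w (ϖ ^ k)) = WithZero.exp (-(2 * k)) := fun k => by
    rw [valued_toPlace_eq_sq_of_ramified L v w hw he, map_zpow₀, hϖ, ← WithZero.exp_zsmul, ← WithZero.exp_nsmul]
    congr 1; simp only [smul_eq_mul, nsmul_eq_mul, Nat.cast_ofNat]; ring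
  have hτ0 : τ ≠ 0 := fun h => by rw [h, map_zero] at hτ; exact WithZero.zero_ne_coe hτ
  obtain ⟨m, hm⟩ : ∃ m : ℤ, Valued.v z = WithZero.exp m := ⟨_, (WithZero.exp_log ((Valuation.ne_zero_iff _).2 hz)).symm⟩
  obtain ⟨k, hk | hk⟩ := Int.even_or_odd' m
  · -- `ord z = 2k` (valuation `exp m`, `m = 2k`): `u := ι ϖ^(k) · z`... with the sign convention `|z| = exp m` we rescale by `ϖ^k`, `|ι ϖ^k| = exp(-2k)`
    refine ⟨toPlace v w (ϖ ^ k) * z, ?_, Or.inl (toPlace_mul_div_galAdicCompletionMap L v w hw (zpow_ne_zero k hϖ0) z).symm⟩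
    rw [map_mul, hιϖ, hm, hk, ← WithZero.exp_add]; convert WithZero.exp_zero using 2; ring
  · -- `ord z` odd: `ι ϖ^(k+1) · z = u · τ` with `u` a unit
    have hu : Valued.v (toPlace v w (ϖ ^ (k + 1)) * z / τ) = 1 := by
      rw [map_div₀, map_mul, hιϖ, hm, hk, hτ, ← WithZero.exp_add, ← WithZero.exp_sub]; convert WithZero.exp_zero using 2; ring
    refine ⟨toPlace v w (ϖ ^ (k + 1)) * z / τ, hu, Or.inr ?_⟩
    rw [← mul_div_galAdicCompletionMap_mul L v w hw, div_mul_cancel₀ _ hτ0, toPlace_mul_div_galAdicCompletionMap L v w hw (zpow_ne_zero (k + 1) hϖ0) z]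

include he in
/-- **THE DICHOTOMY ON THE NORM-ONE TORUS**: every `t` with `σt · t = 1` is `u∕σu` or `u∕σu · τ∕στ` for some UNIT `u ∈ 𝒪_w^×` (Hilbert 90 + normalisation) — `T = T⁽ᵈ⁾ ⊔ (τ∕στ)·T⁽ᵈ⁾`
with `T⁽ᵈ⁾ = {u∕σu}` (§2 tells the kinds apart by depth). [cite: Serre1979, Ch. X §1 Prop. 2, Ch. V §3] [cite: Flicker1998UnitaryFL, Prop. 7 p. 84] -/
theorem exists_eq_div_or_of_norm_one {τ : w.1.adicCompletion L} (hτ : Valued.v τ = WithZero.exp (-1 : ℤ)) {t : w.1.adicCompletion L}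
    (ht : galAdicCompletionMap (L := L) (IsCMField.complexConj L) hw t * t = 1) :
    ∃ u : w.1.adicCompletion L, Valued.v u = 1 ∧
      (t = u / galAdicCompletionMap (L := L) (IsCMField.complexConj L) hw u ∨
        t = u / galAdicCompletionMap (L := L) (IsCMField.complexConj L) hw u * (τ / galAdicCompletionMap (L := L) (IsCMField.complexConj L) hw τ)) := by
  obtain ⟨z, hz, rfl⟩ := exists_eq_div_galAdicCompletionMap_of_norm_one L v w hw he ht
  exact exists_div_galAdicCompletionMap_eq_or L v w hw he hτ hz

include he in
/-- **DEPTHS ON `T`**: `|t − 1| ≤ D` (first kind, depth `≥ d`) or `|t − 1| = D · exp 1` (second kind, depth `d − 1` exactly) — `T⁽ᵈ⁻¹⁾ = T`, and no depth strictly between.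
[cite: Serre1979, Ch. V §3] [cite: Flicker1998UnitaryFL, Prop. 7 p. 84] -/
theorem valued_sub_one_le_or_eq_of_norm_one {τ : w.1.adicCompletion L} (hτ : Valued.v τ = WithZero.exp (-1 : ℤ)) {t : w.1.adicCompletion L}
    (ht : galAdicCompletionMap (L := L) (IsCMField.complexConj L) hw t * t = 1) :
    Valued.v (t - 1) ≤ Valued.v (galAdicCompletionMap (L := L) (IsCMField.complexConj L) hw τ - τ) ∨
      Valued.v (t - 1) = Valued.v (galAdicCompletionMap (L := L) (IsCMField.complexConj L) hw τ - τ) * WithZero.exp (1 : ℤ) := by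
  obtain ⟨u, hu, rfl | rfl⟩ := exists_eq_div_or_of_norm_one L v w hw he hτ ht
  · exact Or.inl (valued_div_galAdicCompletionMap_sub_one_le_of_valued_eq_one L v w hw he hτ hu)
  · exact Or.inr (valued_div_galAdicCompletionMap_mul_sub_one_of_valued_eq_one L v w hw he hτ hu)

include he in
/-- **`T⁽ᵈ⁾ = {u∕σu : u ∈ 𝒪_w^×}`**: a norm-one `t` with `|t − 1| ≤ |στ − τ|` is `u∕σu` for a UNIT `u` (the other coset has depth `d − 1 < d`).
[cite: Serre1979, Ch. V §3] [cite: Flicker1998UnitaryFL, Prop. 7 p. 84] -/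
theorem exists_eq_div_of_norm_one_of_valued_sub_one_le {τ : w.1.adicCompletion L} (hτ : Valued.v τ = WithZero.exp (-1 : ℤ)) {t : w.1.adicCompletion L}
    (ht : galAdicCompletionMap (L := L) (IsCMField.complexConj L) hw t * t = 1)
    (hd : Valued.v (t - 1) ≤ Valued.v (galAdicCompletionMap (L := L) (IsCMField.complexConj L) hw τ - τ)) :
    ∃ u : w.1.adicCompletion L, Valued.v u = 1 ∧ t = u / galAdicCompletionMap (L := L) (IsCMField.complexConj L) hw u := by
  obtain ⟨u, hu, h | h⟩ := exists_eq_div_or_of_norm_one L v w hw he hτ ht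
  · exact ⟨u, hu, h⟩
  · exfalso
    have hD0 := valued_galAdicCompletionMap_sub_self_ne_zero L v w hw he hτ
    rw [h, valued_div_galAdicCompletionMap_mul_sub_one_of_valued_eq_one L v w hw he hτ hu] at hd
    exact absurd hd (not_le.2 (lt_mul_exp_one hD0))

include he in
/-- **THE OTHER COSET**: a norm-one `t` with `¬ |t − 1| ≤ |στ − τ|` is `u∕σu · τ∕στ` for a UNIT `u` (and then `|t − 1| = D · exp 1`). [cite: Serre1979, Ch. V §3] [cite: Flicker1998UnitaryFL, Prop. 7 p. 84] -/
theorem exists_eq_div_mul_of_norm_one_of_not_le {τ : w.1.adicCompletion L} (hτ : Valued.v τ = WithZero.exp (-1 : ℤ)) {t : w.1.adicCompletion L}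
    (ht : galAdicCompletionMap (L := L) (IsCMField.complexConj L) hw t * t = 1)
    (hd : ¬ Valued.v (t - 1) ≤ Valued.v (galAdicCompletionMap (L := L) (IsCMField.complexConj L) hw τ - τ)) :
    ∃ u : w.1.adicCompletion L, Valued.v u = 1 ∧
      t = u / galAdicCompletionMap (L := L) (IsCMField.complexConj L) hw u * (τ / galAdicCompletionMap (L := L) (IsCMField.complexConj L) hw τ) := by
  obtain ⟨u, hu, h | h⟩ := exists_eq_div_or_of_norm_one L v w hw he hτ ht
  · exact absurd (h ▸ valued_div_galAdicCompletionMap_sub_one_le_of_valued_eq_one L v w hw he hτ hu) hd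
  · exact ⟨u, hu, h⟩

/-! ## §4 The σ-depth correspondence, no odd steps, and the kernel -/

/-- **σ-DEPTH CORRESPONDENCE (pointwise)**: for a unit `u` and any `c ∈ ℤᵐ⁰`, `|u∕σu − 1| ≤ c ↔ |σu − u| ≤ c`. [cite: Serre1979, Ch. V §3] [cite: Flicker1998UnitaryFL, Prop. 7 p. 84] -/
theorem valued_div_galAdicCompletionMap_sub_one_le_iff {u : w.1.adicCompletion L} (hu : Valued.v u = 1) (c : WithZero (Multiplicative ℤ)) :
    Valued.v (u / galAdicCompletionMap (L := L) (IsCMField.complexConj L) hw u - 1) ≤ c ↔ Valued.v (galAdicCompletionMap (L := L) (IsCMField.complexConj L) hw u - u) ≤ c := by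
  rw [valued_div_galAdicCompletionMap_sub_one_of_valued_eq_one L v w hw hu]

include he in
/-- **σ-DEPTH CORRESPONDENCE: `T⁽ᵈ⁺²ʲ⁾ = {x∕σx : x ∈ (𝒪_v + ϖ_v^j 𝒪_w)^×}`.**  For a norm-one `t`, a uniformiser `ϖ_v` of `L⁺_v` and `j : ℕ`:
`|t − 1| ≤ exp(−2j) · |στ − τ| ↔ ∃ a b ∈ L⁺_v, |a| = 1 ∧ |b| ≤ 1 ∧ t = x∕σx` with `x = ι a + ι(ϖ_v^j · b) · τ` — i.e. `x` a UNIT of the conductor-`j` order (★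
`valued_galAdicCompletionMap_sub_self_le_iff_mem_order`; `|x| = 1` forces `|a| = 1`).  At a tame place (`d = 1`) this is Flicker's `R_E(j)¹`-filtration step `2j + 1`.
[cite: Flicker1998UnitaryFL, Prop. 7 p. 84] [cite: Serre1979, Ch. V §3] [cite: NeukirchANT1999, Ch. I §12] -/
theorem valued_sub_one_le_iff_exists_of_norm_one {τ : w.1.adicCompletion L} (hτ : Valued.v τ = WithZero.exp (-1 : ℤ))
    {ϖF : v.adicCompletion ↥(maximalRealSubfield L)} (hϖF : Valued.v ϖF = WithZero.exp (-1 : ℤ)) (j : ℕ) {t : w.1.adicCompletion L}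
    (ht : galAdicCompletionMap (L := L) (IsCMField.complexConj L) hw t * t = 1) :
    Valued.v (t - 1) ≤ WithZero.exp (-(2 * j : ℤ)) * Valued.v (galAdicCompletionMap (L := L) (IsCMField.complexConj L) hw τ - τ) ↔
      ∃ a b : v.adicCompletion ↥(maximalRealSubfield L), Valued.v a = 1 ∧ Valued.v b ≤ 1 ∧
        t = (toPlace v w a + toPlace v w (ϖF ^ j * b) * τ) /
          galAdicCompletionMap (L := L) (IsCMField.complexConj L) hw (toPlace v w a + toPlace v w (ϖF ^ j * b) * τ) := by
  have hjb : ∀ {b : v.adicCompletion ↥(maximalRealSubfield L)}, Valued.v b ≤ 1 → Valued.v (ϖF ^ j * b) ≤ 1 := fun hb => by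
    rw [map_mul, map_pow, hϖF]
    refine mul_le_one' (pow_le_one' ?_ _) hb
    rw [← WithZero.exp_zero, WithZero.exp_le_exp]; omega
  constructor
  · intro h
    have hD : Valued.v (t - 1) ≤ Valued.v (galAdicCompletionMap (L := L) (IsCMField.complexConj L) hw τ - τ) := by
      refine h.trans ?_
      have := exp_neg_natCast_mul_le (2 * j) (Valued.v (galAdicCompletionMap (L := L) (IsCMField.complexConj L) hw τ - τ))
      push_cast at this; exact this
    obtain ⟨u, hu, rfl⟩ := exists_eq_div_of_norm_one_of_valued_sub_one_le L v w hw he hτ ht hD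
    rw [valued_div_galAdicCompletionMap_sub_one_of_valued_eq_one L v w hw hu] at h
    obtain ⟨a, b, -, hb, hab⟩ := (valued_galAdicCompletionMap_sub_self_le_iff_mem_order L v w hw he hτ hϖF j hu.le).1 h
    refine ⟨a, b, ?_, hb, by rw [hab]⟩
    -- `|a| = 1`: `1 = |u| = max (|a|²) (|ϖ^j b|² · exp(−1))` and the odd term is never `1`
    have hval := valued_toPlace_add_toPlace_mul L v w hw he hτ a (ϖF ^ j * b)
    rw [← hab, hu] at hval
    rcases max_eq_iff.1 hval.symm with ⟨ha, -⟩ | ⟨hb', -⟩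
    · exact eq_of_sq_eq_sq (by rw [ha, one_pow])
    · exfalso
      rcases eq_or_ne (ϖF ^ j * b) 0 with h0 | h0
      · rw [h0, map_zero, zero_pow two_ne_zero, zero_mul] at hb'; exact zero_ne_one hb'
      · exact sq_ne_sq_mul_exp_neg_one one_ne_zero ((Valuation.ne_zero_iff _).2 h0) (by rw [one_pow]; exact hb'.symm)
  · rintro ⟨a, b, ha, hb, rfl⟩
    have hx : Valued.v (toPlace v w a + toPlace v w (ϖF ^ j * b) * τ) = 1 := by
      rw [valued_toPlace_add_toPlace_mul L v w hw he hτ, ha, one_pow, max_eq_left]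
      exact (sq_mul_exp_neg_one_le_one_iff _).2 (hjb hb)
    rw [valued_div_galAdicCompletionMap_sub_one_of_valued_eq_one L v w hw hx]
    exact (valued_galAdicCompletionMap_sub_self_le_iff_mem_order L v w hw he hτ hϖF j hx.le).2 ⟨a, b, ha.le, hb, rfl⟩

include he in
/-- **NO ODD STEPS ON `T` ABOVE DEPTH `d`**: `|t − 1| ≤ exp(−(2j+1)) · D → |t − 1| ≤ exp(−2(j+1)) · D` for a norm-one `t` (`t = u∕σu` and `|σu − u| = |q|² · D`, ★
`valued_galAdicCompletionMap_sub_self_toPlace_add_toPlace_mul`) — `T⁽ᵈ⁺²ʲ⁺¹⁾ = T⁽ᵈ⁺²ʲ⁺²⁾`, the step the index count divides by. [cite: Serre1979, Ch. IV §1, Ch. V §3] [cite: Flicker1998UnitaryFL, Prop. 7 p. 84] -/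
theorem valued_sub_one_le_of_le_odd_of_norm_one {τ : w.1.adicCompletion L} (hτ : Valued.v τ = WithZero.exp (-1 : ℤ)) {t : w.1.adicCompletion L}
    (ht : galAdicCompletionMap (L := L) (IsCMField.complexConj L) hw t * t = 1) (j : ℕ)
    (h : Valued.v (t - 1) ≤ WithZero.exp (-(2 * j + 1 : ℤ)) * Valued.v (galAdicCompletionMap (L := L) (IsCMField.complexConj L) hw τ - τ)) :
    Valued.v (t - 1) ≤ WithZero.exp (-(2 * ((j + 1 : ℕ) : ℤ))) * Valued.v (galAdicCompletionMap (L := L) (IsCMField.complexConj L) hw τ - τ) := by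
  have hD0 := valued_galAdicCompletionMap_sub_self_ne_zero L v w hw he hτ
  have hD : Valued.v (t - 1) ≤ Valued.v (galAdicCompletionMap (L := L) (IsCMField.complexConj L) hw τ - τ) := by
    refine h.trans ?_
    have := exp_neg_natCast_mul_le (2 * j + 1) (Valued.v (galAdicCompletionMap (L := L) (IsCMField.complexConj L) hw τ - τ))
    push_cast at this; exact this
  obtain ⟨u, hu, rfl⟩ := exists_eq_div_of_norm_one_of_valued_sub_one_le L v w hw he hτ ht hD
  rw [valued_div_galAdicCompletionMap_sub_one_of_valued_eq_one L v w hw hu] at h ⊢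
  obtain ⟨p, q, rfl⟩ := exists_eq_toPlace_add_toPlace_mul L v w hw he hτ u
  rw [valued_galAdicCompletionMap_sub_self_toPlace_add_toPlace_mul L v w hw he τ p q, mul_le_mul_iff_of_pos_right (zero_lt_iff.2 hD0)] at h ⊢
  rcases eq_or_ne q 0 with hq0 | hq0
  · rw [hq0, map_zero, zero_pow two_ne_zero]; exact zero_le
  obtain ⟨m, hm⟩ : ∃ m : ℤ, Valued.v q = WithZero.exp m := ⟨_, (WithZero.exp_log ((Valuation.ne_zero_iff _).2 hq0)).symm⟩
  rw [hm, ← WithZero.exp_nsmul, WithZero.exp_le_exp] at h ⊢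
  simp only [nsmul_eq_mul, Nat.cast_ofNat] at h ⊢
  push_cast at h ⊢
  omega

/-- **THE KERNEL OF `z ↦ z∕σz`**: for `x, y ≠ 0`, `x∕σx = y∕σy ↔ y = ι c · x` for some `c ∈ L⁺_v` (`y∕x` is `σ`-fixed, hence descends by ★ `exists_toPlace_eq_of_galAdicCompletionMap_eq`).
[cite: Serre1979, Ch. X §1 Prop. 2] -/
theorem div_galAdicCompletionMap_eq_div_galAdicCompletionMap_iff {x y : w.1.adicCompletion L} (hx : x ≠ 0) (hy : y ≠ 0) :
    x / galAdicCompletionMap (L := L) (IsCMField.complexConj L) hw x = y / galAdicCompletionMap (L := L) (IsCMField.complexConj L) hw y ↔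
      ∃ c : v.adicCompletion ↥(maximalRealSubfield L), y = toPlace v w c * x := by
  have hσx : galAdicCompletionMap (L := L) (IsCMField.complexConj L) hw x ≠ 0 := (_root_.map_ne_zero _).2 hx
  have hσy : galAdicCompletionMap (L := L) (IsCMField.complexConj L) hw y ≠ 0 := (_root_.map_ne_zero _).2 hy
  constructor
  · intro h
    rw [div_eq_div_iff hσx hσy] at h
    have hfix : galAdicCompletionMap (L := L) (IsCMField.complexConj L) hw (y / x) = y / x := by
      rw [map_div₀, div_eq_div_iff hσx hx]
      linear_combination h
    obtain ⟨c, hc⟩ := exists_toPlace_eq_of_galAdicCompletionMap_eq (IsCMField.complexConj L) w (IsCMField.complexConj_ne_one L) hw _ hfix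
    exact ⟨c, by rw [hc, div_mul_cancel₀ y hx]⟩
  · rintro ⟨c, rfl⟩
    have hc : c ≠ 0 := by rintro rfl; exact hy (by rw [map_zero, zero_mul])
    exact (toPlace_mul_div_galAdicCompletionMap L v w hw hc x).symm

include he in
/-- The kernel on UNITS: for `|x| = |y| = 1`, `x∕σx = y∕σy ↔ y = ι c · x` with `|c| = 1` (`|ι c| = |c|²`). [cite: Serre1979, Ch. X §1 Prop. 2, Ch. V §3] [cite: Flicker1998UnitaryFL, Prop. 7 p. 84] -/
theorem div_galAdicCompletionMap_eq_div_galAdicCompletionMap_iff_of_valued_eq_one {x y : w.1.adicCompletion L} (hx : Valued.v x = 1) (hy : Valued.v y = 1) :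
    x / galAdicCompletionMap (L := L) (IsCMField.complexConj L) hw x = y / galAdicCompletionMap (L := L) (IsCMField.complexConj L) hw y ↔
      ∃ c : v.adicCompletion ↥(maximalRealSubfield L), Valued.v c = 1 ∧ y = toPlace v w c * x := by
  rw [div_galAdicCompletionMap_eq_div_galAdicCompletionMap_iff L v w hw (ne_zero_of_valued_eq_one L v w hx) (ne_zero_of_valued_eq_one L v w hy)]
  constructor
  · rintro ⟨c, rfl⟩
    refine ⟨c, ?_, rfl⟩
    rw [map_mul, hx, mul_one, valued_toPlace_eq_sq_of_ramified L v w hw he] at hy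
    exact eq_of_sq_eq_sq (by rw [hy, one_pow])
  · rintro ⟨c, -, h⟩
    exact ⟨c, h⟩

end Literature.NumberTheory.Automorphic.UnitaryGroup

end
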